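import Literature.NumberTheory.EllipticCurves.IsogenyTwoTorsionProofs
import Literature.NumberTheory.EllipticCurves.IsogenyVariableChangeProofs
import Literature.NumberTheory.EllipticCurves.IsogenyCompProofs
import Literature.NumberTheory.EllipticCurves.IsogenyIdProofs
import Literature.NumberTheory.EllipticCurves.IsogenyGeomEndRingProofs
import Literature.NumberTheory.EllipticCurves.GaloisActionProofs
import Literature.NumberTheory.EllipticCurves.FrobeniusEndomorphism
import HarnessLib

/-!
# Quotients of an elliptic curve by cyclic `2`-power subgroups, via chains of `2`-isogenies

Sibling file of `Literature.NumberTheory.EllipticCurves.Isogeny` (D-0014; theorems only),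
serving the finite-field part of `Literature.AlgebraicGeometry.Motives.FaltingsEC` — Tate's
theorem `Literature.AlgebraicGeometry.Motives.mem_span_range_tateEndRingHom_iff_of_finite` — whose proof in the tree
(`FaltingsECTateProp1Proofs`, `FaltingsECTateMainTheoremProofs`) uses quotient isogenies
`E → E/S → E` by `Γ_k`-stable cyclic subgroups `S ⊆ E(k̄)` of prime-power order (Tate, Invent.
Math. 2 (1966), §2, proof of Proposition 1), supplied there as the hypothesis `hquot` (the body
of the named fact `WeierstrassCurve.exists_isogeny_ker_eq_and_comp_eq_nsmul`, Silverman, *AEC*,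
Prop. III.4.12, Rem. III.4.13.2, Thm. III.6.1–6.2). This file **proves** that statement for
cyclic subgroups of **`2`-power order** over a finite field of odd characteristic, from
Silverman's explicit `2`-isogeny (*AEC*, III.4, Example 4.5; the tree's
`WeierstrassCurve.twoIsogeny` of `IsogenyTwoTorsionProofs`):

* `WeierstrassCurve.exists_isogeny_twoIsogeny_comp_eq_two_nsmul`: for `E₁ : y² = x³ + ax² + bx`
  (two-torsion normal form, elliptic) and Silverman's `φ : E₁ → E₂`, there is an isogeny
  `φ' : E₂ → E₁` over `K` with `φ' ∘ φ = [2]` — namely the `2`-isogeny of `E₂` (whose `T = (0,0)`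
  generates `φ(E₁[2])`) followed by the isomorphism `(X, Y) ↦ (X/4, Y/8)` of its codomain
  `Y² = X³ + 4aX² + 16bX` onto `E₁` (Silverman, *AEC*, III.4.5 with III.6.1: `φ̂ ∘ φ = [2]`);
* `WeierstrassCurve.exists_isogeny_ker_eq_pair`: for an elliptic curve `E` over `K`
  (`char K ≠ 2`) and a `K`-rational point `T` of order `2`, an elliptic curve `B` over `K` and
  isogenies `g : E → B`, `f : B → E` over `K` with `ker g = {O, T}`, `f g = [2]`, `g f = [2]`
  (move `T` to `(0, 0)` and `a₁ = a₃ = 0` by a change of variables over `K`, then the above);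
* `WeierstrassCurve.exists_isogeny_ker_eq_zmultiples_of_addOrderOf_eq_two_pow`: for `E` over a
  **finite** field `k` of odd characteristic and a point `P ∈ E(k̄)` of order `2 ^ n` whose cyclic
  group `⟨P⟩` is stable under the Frobenius, an elliptic curve `B / k` and isogenies `g : E → B`,
  `f : B → E` over `k` with `ker g = ⟨P⟩`, `f g = [2 ^ n]`, `g f = [2 ^ n]` (induction on `n`:
  the point `2^{n-1} P` of order `2` is `k`-rational, being the unique element of order `2` of the
  Frobenius-stable group `⟨P⟩`).

Everything is elementary given the tree's `twoIsogeny`: the identity `x(φ'(φ P)) = x(2P)` is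
checked on coordinates (`(x² - b)²/(4y²)`, Silverman, *AEC*, III.2.3(d)), whence `φ' φ = ±[2]`
off `E[2]` and then everywhere, the maps `φ' φ ∓ [2]` being `0` or isogenies with finite kernel
(*AEC* III.§4, the tree's `mem_geomEndRing_iff_holds`); `g f = [2]` follows from `f g = [2]`
because the image of `g` is infinite.

## References

* [SilvermanAEC2009] J. H. Silverman, *The Arithmetic of Elliptic Curves*, 2nd ed., GTM 106,
  III.1 (Table 3.1), III.2.3(d), III.4 Example 4.5, Prop. III.4.12, Rem. III.4.13.2,
  Thm. III.6.1–6.2.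
* [Tate1966Endomorphisms] J. Tate, *Endomorphisms of abelian varieties over finite fields*,
  Invent. Math. 2 (1966), 134–144, §2, proof of Proposition 1.
-/

noncomputable section

open scoped Classical

universe u

namespace WeierstrassCurve

open geomPoints

variable {K : Type u} [Field K]

/-! ## Transport of isogenies along an equality of the target equation -/

/-- Transporting an isogeny along an equality `W₁ = W₂` of target equations does not change the
coordinates of its values. [folklore] -/
theorem Isogeny.xy_cast_apply {W W₁ W₂ : WeierstrassCurve K} (h : W₁ = W₂) (φ : Isogeny W W₁)
    (P : W.geomPoints) : xy ((congrArg (Isogeny W) h).mp φ P) = xy (φ P) := by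
  subst h
  rfl

/-- Transporting an isogeny along an equality of target equations preserves vanishing. [folklore] -/
theorem Isogeny.cast_apply_eq_zero_iff {W W₁ W₂ : WeierstrassCurve K} (h : W₁ = W₂)
    (φ : Isogeny W W₁) (P : W.geomPoints) : (congrArg (Isogeny W) h).mp φ P = 0 ↔ φ P = 0 := by
  subst h
  rfl

/-- Transporting an isogeny along an equality of target equations, on an affine value. [folklore] -/
theorem Isogeny.exists_cast_apply_eq_some {W W₁ W₂ : WeierstrassCurve K} (h : W₁ = W₂)
    (φ : Isogeny W W₁) (P : W.geomPoints) {a b : AlgebraicClosure K}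
    {hab : (W₁.baseChange (AlgebraicClosure K)).toAffine.Nonsingular a b}
    (hP : φ P = Affine.Point.some a b hab) :
    ∃ hab', (congrArg (Isogeny W) h).mp φ P = (Affine.Point.some a b hab' : W₂.geomPoints) := by
  subst h
  exact ⟨hab, hP⟩

/-- Transport and a change of variables of the source compose as expected (used for
`C⁻¹ • C • W = W`): the transported isogeny is still injective. [folklore] -/
theorem Isogeny.cast_injective {W W₁ W₂ : WeierstrassCurve K} (h : W₁ = W₂) (φ : Isogeny W W₁)
    (hφ : Function.Injective φ) : Function.Injective ((congrArg (Isogeny W) h).mp φ) := by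
  subst h
  exact hφ

/-! ## Elements of `End_K(E)`: zero or finite kernel -/

/-- An element of `End_K(E)` is zero or has finite kernel (it is then algebraic, Silverman,
*AEC*, III.§4; the tree's `mem_geomEndRing_iff_holds` and `IsAlgebraicOn.finite_ker`).
[cite: SilvermanAEC2009, III.§4] -/
theorem eq_zero_or_finite_ker_of_mem_endRing {W : WeierstrassCurve K} [W.IsElliptic]
    {ψ : AddMonoid.End W.geomPoints} (hψ : ψ ∈ W.endRing) :
    ψ = 0 ∨ ((ψ : W.geomPoints →+ W.geomPoints).ker : Set W.geomPoints).Finite := by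
  rcases (mem_geomEndRing_iff_holds W ψ).mp (W.endRing_le_geomEndRing hψ) with h0 | halg
  · exact Or.inl h0
  · exact Or.inr (IsAlgebraicOn.finite_ker halg)

/-- **Two elements of `End_K(E)` which agree up to sign off a finite set differ by a sign.**
If `φ P = ψ P` or `φ P = -ψ P` for all `P` outside a finite set, then `φ = ψ` or `φ = -ψ`: the
maps `φ ∓ ψ ∈ End_K(E)` are `0` or have finite kernel (Silverman, *AEC*, III.§4), and `E(K̄)` is
infinite. [folklore] -/
theorem eq_or_eq_neg_of_forall_apply {W : WeierstrassCurve K} [W.IsElliptic]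
    {φ ψ : AddMonoid.End W.geomPoints} (hφ : φ ∈ W.endRing) (hψ : ψ ∈ W.endRing)
    {S : Set W.geomPoints} (hS : S.Finite) (h : ∀ P ∉ S, φ P = ψ P ∨ φ P = -ψ P) :
    φ = ψ ∨ φ = -ψ := by
  rcases eq_zero_or_finite_ker_of_mem_endRing (sub_mem hφ hψ) with h0 | hA
  · exact Or.inl (sub_eq_zero.mp h0)
  rcases eq_zero_or_finite_ker_of_mem_endRing (add_mem hφ hψ) with h0 | hB
  · exact Or.inr (eq_neg_of_add_eq_zero_left h0)
  exfalso
  refine Set.infinite_univ (α := W.geomPoints) ((hS.union (hA.union hB)).subset fun P _ ↦ ?_)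
  by_cases hP : P ∈ S
  · exact Or.inl hP
  · rcases h P hP with e | e
    · refine Or.inr (Or.inl ?_)
      change φ P - ψ P = 0
      rw [e, sub_self]
    · refine Or.inr (Or.inr ?_)
      change φ P + ψ P = 0
      rw [e, neg_add_cancel]

/-! ## `g ∘ f = [n]` from `f ∘ g = [n]` -/

/-- **`f g = [n]` implies `g f = [n]`** for isogenies `g : E → B`, `f : B → E` of elliptic curves
over `K`: the map `g f - [n] ∈ End_K(B)` kills the image of `g`, which is infinite (the kernel of
`g` is finite and `E(K̄)` is infinite), so it is not an isogeny, hence it is `0` (Silverman,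
*AEC*, III.§4; cf. Thm. III.6.2(a), `φ φ̂ = [m]` from `φ̂ φ = [m]`).
[cite: SilvermanAEC2009, Thm. III.6.2(a) (proof)] -/
theorem Isogeny.comp_apply_eq_nsmul_of_comp_apply_eq_nsmul {W B : WeierstrassCurve K}
    [W.IsElliptic] [B.IsElliptic] (g : Isogeny W B) (f : Isogeny B W) {n : ℕ}
    (hfg : ∀ P, f (g P) = n • P) (Q : B.geomPoints) : g (f Q) = n • Q := by
  set ψ : AddMonoid.End B.geomPoints :=
    (show AddMonoid.End B.geomPoints from (g.comp f).toAddMonoidHom) -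
      (n : AddMonoid.End B.geomPoints) with hψdef
  have hψmem : ψ ∈ B.endRing := sub_mem (g.comp f).toAddMonoidHom_mem_endRing (natCast_mem _ n)
  have hψapp : ∀ Q, ψ Q = g (f Q) - n • Q := fun Q ↦ by
    rw [← Isogeny.comp_apply, ← AddMonoid.End.natCast_apply n Q]
    rfl
  rcases eq_zero_or_finite_ker_of_mem_endRing hψmem with h0 | hfin
  · have h1 : ψ Q = 0 := by rw [h0]; rfl
    rw [hψapp] at h1
    exact sub_eq_zero.mp h1
  · exfalso
    -- the image of `g` lies in the finite kernel of `ψ`, and is infinite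
    have hsub : Set.range g ⊆
        ((show B.geomPoints →+ B.geomPoints from ψ).ker : Set B.geomPoints) := by
      rintro _ ⟨P, rfl⟩
      have h1 : ψ (g P) = 0 := by rw [hψapp, hfg, map_nsmul, sub_self]
      exact h1
    have hinf : (Set.range g).Infinite := fun hfinR ↦
      Set.infinite_univ ((Literature.NumberTheory.EllipticCurves.AddMonoidHom.finite_preimage_of_finite_ker g.toAddMonoidHom
        g.finite_ker hfinR).subset fun P _ ↦ ⟨P, rfl⟩)
    exact hinf (hfin.subset hsub)

/-! ## The dual of Silverman's `2`-isogeny: `φ' ∘ φ = [2]` on `E₁ : y² = x³ + ax² + bx` -/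

section NormalForm

variable (W : WeierstrassCurve K) [W.IsTwoTorsionNF] [W.IsElliptic]

/-- The scaling `(u, r, s, t) = (2, 0, 0, 0)` carries the codomain `Y² = X³ + 4aX² + 16bX` of the
`2`-isogeny of `E₂ : Y² = X³ - 2aX² + (a² - 4b)X` back onto `E₁ : y² = x³ + ax² + bx`
(Silverman, *AEC*, III.1, Table 3.1: `aᵢ ↦ u⁻ⁱ aᵢ`). [folklore] -/
theorem two_smul_twoIsogenyCodomain_twoIsogenyCodomain :
    (⟨Units.mk0 (2 : K) (two_ne_zero' W), 0, 0, 0⟩ : VariableChange K) •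
        W.twoIsogenyCodomain.twoIsogenyCodomain = W := by
  have h2 : (2 : K) ≠ 0 := two_ne_zero' W
  ext
  · simp only [variableChange_a₁, a₁_of_isTwoTorsionNF]
    ring
  · simp only [variableChange_a₂, twoIsogenyCodomain_a₂, twoIsogenyCodomain_a₁, Units.val_inv_eq_inv_val,
      Units.val_mk0]
    field_simp
    ring
  · simp only [variableChange_a₃, twoIsogenyCodomain_a₁, a₃_of_isTwoTorsionNF]
    ring
  · simp only [variableChange_a₄, twoIsogenyCodomain_a₄, twoIsogenyCodomain_a₃, twoIsogenyCodomain_a₂,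
      twoIsogenyCodomain_a₁, Units.val_inv_eq_inv_val, Units.val_mk0]
    field_simp
    ring
  · simp only [variableChange_a₆, twoIsogenyCodomain_a₄, twoIsogenyCodomain_a₃, twoIsogenyCodomain_a₂,
      twoIsogenyCodomain_a₁, a₆_of_isTwoTorsionNF]
    ring

/-- The coordinate identity behind `φ' φ = [2]`: with `X = (x² + ax + b)/x` and
`X₃ = (X² - 2aX + (a² - 4b))/X`, one has `X₃/4 · (2y)² = (x² - b)²` on
`y² = x³ + ax² + bx` (so `X₃/4 = x(2P)`, Silverman, *AEC*, III.2.3(d)). [folklore] -/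
theorem twoIsogeny_dual_x_identity {F : Type*} [Field F] {x y a b : F} (hx : x ≠ 0)
    (hq : x ^ 2 + a * x + b ≠ 0) (h2 : (2 : F) ≠ 0)
    (hrel : y ^ 2 = x ^ 3 + a * x ^ 2 + b * x) :
    (2 : F)⁻¹ ^ 2 * ((((x ^ 2 + a * x + b) / x) ^ 2 + (-2 * a) * ((x ^ 2 + a * x + b) / x) +
        (a ^ 2 - 4 * b)) / ((x ^ 2 + a * x + b) / x) - 0) * (2 * y) ^ 2 = (x ^ 2 - b) ^ 2 := by
  rw [show (2 * y) ^ 2 = 4 * y ^ 2 by ring, hrel]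
  generalize hq' : x ^ 2 + a * x + b = q at hq ⊢
  have hb : b = q - x ^ 2 - a * x := by rw [← hq']; ring
  subst hb
  field_simp
  ring

/-- **The dual of Silverman's `2`-isogeny.** For `E₁ : y² = x³ + ax² + bx` in two-torsion normal
form (elliptic, so `char K ≠ 2`) and Silverman's `φ : E₁ → E₂ : Y² = X³ - 2aX² + (a² - 4b)X`,
`(x, y) ↦ (y²/x², y(x² - b)/x²)` (the tree's `twoIsogeny`), there is an isogeny `φ' : E₂ → E₁`
over `K` with `φ' (φ P) = 2P` for all `P ∈ E₁(K̄)`: the `2`-isogeny of `E₂` followed by the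
scaling `(X, Y) ↦ (X/4, Y/8)` of its codomain `Y² = X³ + 4aX² + 16bX` onto `E₁`, corrected by the
sign `[-1]` if necessary. (`x(φ'(φ P)) = (x² - b)²/(4y²) = x(2P)`, Silverman, *AEC*, III.2.3(d),
so `φ' φ = ±[2]` off `E₁[2]`, hence one of `φ' φ ∓ [2] ∈ End_K(E₁)` has infinite kernel and
vanishes.) Silverman, *AEC*, III.4 Example 4.5 with Thm. III.6.1(a) (`φ̂ ∘ φ = [deg φ] = [2]`).
[cite: SilvermanAEC2009, III.4 Example 4.5 and Thm. III.6.1(a)] -/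
theorem exists_isogeny_twoIsogeny_comp_eq_two_nsmul :
    ∃ f : Isogeny W.twoIsogenyCodomain W, ∀ P, f (W.twoIsogeny P) = 2 • P := by
  have h2 : (2 : K) ≠ 0 := two_ne_zero' W
  have h2L : (2 : AlgebraicClosure K) ≠ 0 := two_ne_zero' (W.baseChange (AlgebraicClosure K))
  -- the scaling back onto `W` and the candidate dual
  have hCE := two_smul_twoIsogenyCodomain_twoIsogenyCodomain W
  let f₀ : Isogeny W.twoIsogenyCodomain W :=
    ((congrArg (Isogeny W.twoIsogenyCodomain.twoIsogenyCodomain) hCE).mp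
      (VariableChange.toIsogeny W.twoIsogenyCodomain.twoIsogenyCodomain
        (⟨Units.mk0 (2 : K) (two_ne_zero' W), 0, 0, 0⟩ : VariableChange K))).comp
      W.twoIsogenyCodomain.twoIsogeny
  -- coefficients over `K̄`
  have ha₂ : (W.twoIsogenyCodomain.baseChange (AlgebraicClosure K)).a₂ =
      -2 * (W.baseChange (AlgebraicClosure K)).a₂ := by
    simp [baseChange, twoIsogenyCodomain_a₂, map_a₂, map_ofNat]
  have ha₄ : (W.twoIsogenyCodomain.baseChange (AlgebraicClosure K)).a₄ =
      (W.baseChange (AlgebraicClosure K)).a₂ ^ 2 - 4 * (W.baseChange (AlgebraicClosure K)).a₄ := by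
    simp [baseChange, twoIsogenyCodomain_a₄, map_a₂, map_a₄, map_ofNat]
  have hu : ((((⟨Units.mk0 (2 : K) (two_ne_zero' W), 0, 0, 0⟩ : VariableChange K).map
      (algebraMap K (AlgebraicClosure K))).u⁻¹ : (AlgebraicClosure K)ˣ) : AlgebraicClosure K) =
        (2 : AlgebraicClosure K)⁻¹ := by
    simp [VariableChange.map, Units.val_inv_eq_inv_val, map_ofNat]
  have hr : ((⟨Units.mk0 (2 : K) (two_ne_zero' W), 0, 0, 0⟩ : VariableChange K).map
      (algebraMap K (AlgebraicClosure K))).r = 0 := by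
    simp [VariableChange.map]
  -- off `E₁[2]`, `f₀ (φ P) = ±2P`
  have key : ∀ P : W.geomPoints, P ∉ ((geomTorsion W 2 : AddSubgroup W.geomPoints) : Set W.geomPoints) →
      f₀ (W.twoIsogeny P) = 2 • P ∨ f₀ (W.twoIsogeny P) = -(2 • P) := by
    intro P hP
    have h2P : (2 : ℕ) • P ≠ 0 := fun h0 ↦ hP ((Submodule.mem_torsionBy_iff _ _).mpr (by
      exact_mod_cast h0))
    change (W.baseChange (AlgebraicClosure K)).toAffine.Point at P
    rcases P with _ | ⟨x, y, h⟩
    · exact (h2P (smul_zero 2)).elim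
    have hy : y ≠ (W.baseChange (AlgebraicClosure K)).toAffine.negY x y := fun hy ↦
      h2P (by rw [two_nsmul]; exact Affine.Point.add_self_of_Y_eq hy)
    have hy0 : y ≠ 0 := fun h0 ↦ hy (by rw [negY_of_isTwoTorsionNF, h0, neg_zero])
    have hrel := rel_of_nonsingular (W.baseChange (AlgebraicClosure K)) h
    have hx : x ≠ 0 := by
      rintro rfl
      exact hy0 (pow_eq_zero_iff two_ne_zero |>.mp (by rw [hrel]; ring))
    have hq : x ^ 2 + (W.baseChange (AlgebraicClosure K)).a₂ * x +
        (W.baseChange (AlgebraicClosure K)).a₄ ≠ 0 := by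
      intro hq
      refine hy0 (pow_eq_zero_iff two_ne_zero |>.mp ?_)
      rw [hrel]
      linear_combination x * hq
    -- `φ P`
    obtain ⟨h₁, e₁⟩ := twoIsogenyGeomHom_some W h hx
    have hX : (W.baseChange (AlgebraicClosure K)).twoIsogenyX x ≠ 0 := by
      simp only [twoIsogenyX]
      exact div_ne_zero hq hx
    -- `φ₂ (φ P)`
    obtain ⟨h₂, e₂⟩ := twoIsogenyGeomHom_some W.twoIsogenyCodomain h₁ hX
    -- the scaling and the transport
    have e₃ := VariableChange.toIsogeny_some W.twoIsogenyCodomain.twoIsogenyCodomain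
      (⟨Units.mk0 (2 : K) (two_ne_zero' W), 0, 0, 0⟩ : VariableChange K) h₂
    obtain ⟨h₄, e₄⟩ := Isogeny.exists_cast_apply_eq_some hCE _ _ e₃
    have ef : f₀ (W.twoIsogeny (Affine.Point.some x y h)) = Affine.Point.some _ _ h₄ := by
      show ((congrArg (Isogeny W.twoIsogenyCodomain.twoIsogenyCodomain) hCE).mp
        (VariableChange.toIsogeny W.twoIsogenyCodomain.twoIsogenyCodomain
          (⟨Units.mk0 (2 : K) (two_ne_zero' W), 0, 0, 0⟩ : VariableChange K)))
          (W.twoIsogenyCodomain.twoIsogeny (W.twoIsogeny (Affine.Point.some x y h))) = _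
      rw [twoIsogeny_apply W, e₁, twoIsogeny_apply W.twoIsogenyCodomain, e₂, e₄]
    -- `2P`
    have e2P : (2 : ℕ) • (show W.geomPoints from Affine.Point.some x y h) =
        (Affine.Point.some _ _ ((Affine.nonsingular_add h h fun hxy ↦ hy hxy.right)) : W.geomPoints) := by
      rw [two_nsmul]
      exact Affine.Point.add_self_of_Y_ne hy
    -- the `x`-coordinates agree
    have hx₄ : ((⟨Units.mk0 (2 : K) (two_ne_zero' W), 0, 0, 0⟩ : VariableChange K).map
        (algebraMap K (AlgebraicClosure K))).toX
          ((W.twoIsogenyCodomain.baseChange (AlgebraicClosure K)).twoIsogenyX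
            ((W.baseChange (AlgebraicClosure K)).twoIsogenyX x)) =
        (W.baseChange (AlgebraicClosure K)).toAffine.addX x x
          ((W.baseChange (AlgebraicClosure K)).toAffine.slope x x y y) := by
      have h4y : (2 * y) ^ 2 ≠ 0 := pow_ne_zero _ (mul_ne_zero h2L hy0)
      refine mul_right_cancel₀ h4y ?_
      rw [addX_self_mul _ h hy, VariableChange.toX_def, hu, hr, twoIsogenyX, twoIsogenyX, ha₂, ha₄]
      exact twoIsogeny_dual_x_identity hx hq h2L hrel
    rw [ef, e2P]
    exact Affine.Point.X_eq_iff.mp hx₄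
  -- hence `f₀ ∘ φ = ±[2]` in `End_K(E₁)`
  haveI : Finite (geomTorsion W 2) := finite_torsionPoints_holds W (AlgebraicClosure K) two_ne_zero
  have hfin : ((geomTorsion W 2 : AddSubgroup W.geomPoints) : Set W.geomPoints).Finite :=
    Set.toFinite _
  rcases eq_or_eq_neg_of_forall_apply (f₀.comp W.twoIsogeny).toAddMonoidHom_mem_endRing
      (natCast_mem W.endRing 2) hfin (fun P hP ↦ by
        rw [AddMonoid.End.natCast_apply]
        exact key P hP) with hplus | hminus
  · refine ⟨f₀, fun P ↦ ?_⟩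
    have e := congrArg (fun χ : AddMonoid.End W.geomPoints ↦ χ P) hplus
    simp only [AddMonoid.End.natCast_apply] at e
    exact e
  · obtain ⟨f, hf⟩ := f₀.exists_toAddMonoidHom_eq_neg
    refine ⟨f, fun P ↦ ?_⟩
    have e : f (W.twoIsogeny P) = -(f₀ (W.twoIsogeny P)) := by
      have := congrArg (fun χ : W.twoIsogenyCodomain.geomPoints →+ W.geomPoints ↦
        χ (W.twoIsogeny P)) hf
      simpa using this
    have e' : f₀ (W.twoIsogeny P) = -(2 • P) := by
      have := congrArg (fun χ : AddMonoid.End W.geomPoints ↦ χ P) hminus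
      rw [← AddMonoid.End.natCast_apply 2 P]
      exact this
    rw [e, e', neg_neg]

end NormalForm

/-! ## Quotient by a rational point of order `2` -/

/-- The inverse change of variables undoes the substitution on `x`: `(C⁻¹).toX = C.ofX`
(Silverman, *AEC*, III.1, Table 3.1). [folklore] -/
theorem VariableChange.toX_inv {R : Type*} [CommRing R] (C : VariableChange R) (x : R) :
    C⁻¹.toX x = C.ofX x := by
  simp only [VariableChange.toX_def, VariableChange.ofX_def, VariableChange.inv_def, inv_inv]
  have hu : (C.u : R) * (C.u⁻¹ : Rˣ) = 1 := Units.mul_inv C.u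
  linear_combination (C.r * (C.u : R) * (C.u⁻¹ : Rˣ) + C.r) * hu

/-- The inverse change of variables undoes the substitution on `y`: `(C⁻¹).toY = C.ofY`
(Silverman, *AEC*, III.1, Table 3.1). [folklore] -/
theorem VariableChange.toY_inv {R : Type*} [CommRing R] (C : VariableChange R) (x y : R) :
    C⁻¹.toY x y = C.ofY x y := by
  simp only [VariableChange.toY_def, VariableChange.ofY_def, VariableChange.inv_def, inv_inv]
  have hu : (C.u : R) * (C.u⁻¹ : Rˣ) = 1 := Units.mul_inv C.u
  linear_combination
    (C.s * x * (C.u : R) ^ 2 +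
      C.t * ((C.u : R) ^ 2 * (C.u⁻¹ : Rˣ) ^ 2 + (C.u : R) * (C.u⁻¹ : Rˣ) + 1)) * hu

/-- **The round trip `W → C • W → C⁻¹ • C • W = W` is the identity on `E(K̄)`** (the isogenies
of a change of variables and of its inverse, the latter transported along `C⁻¹ • C • W = W`).
Silverman, *AEC*, III.3.1(b). [folklore] -/
theorem VariableChange.cast_toIsogeny_inv_toIsogeny (W : WeierstrassCurve K) (C : VariableChange K)
    (P : W.geomPoints) :
    (congrArg (Isogeny (C • W)) (inv_smul_smul C W)).mp (VariableChange.toIsogeny (C • W) C⁻¹)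
      (VariableChange.toIsogeny W C P) = P := by
  by_cases hP : P = 0
  · subst hP
    rw [map_zero, map_zero]
  have hne : (congrArg (Isogeny (C • W)) (inv_smul_smul C W)).mp
      (VariableChange.toIsogeny (C • W) C⁻¹) (VariableChange.toIsogeny W C P) ≠ 0 := by
    rw [Ne, Isogeny.cast_apply_eq_zero_iff (inv_smul_smul C W)]
    intro h0
    exact hP (VariableChange.toIsogeny_injective W C
      ((VariableChange.toIsogeny_injective (C • W) C⁻¹ (h0.trans (map_zero _).symm)).trans
        (map_zero _).symm))
  refine eq_of_xy_eq hne hP ?_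
  rw [Isogeny.xy_cast_apply (inv_smul_smul C W)]
  change (W.baseChange (AlgebraicClosure K)).toAffine.Point at P
  rcases P with _ | ⟨x, y, h⟩
  · exact absurd rfl hP
  · rw [VariableChange.toIsogeny_some W C h, VariableChange.toIsogeny_some (C • W) C⁻¹, xy_some,
      xy_some, show C⁻¹.map (algebraMap K (AlgebraicClosure K)) =
        (C.map (algebraMap K (AlgebraicClosure K)))⁻¹ from
          map_inv (VariableChange.mapHom (algebraMap K (AlgebraicClosure K))) C,
      VariableChange.toX_inv, VariableChange.toY_inv, VariableChange.ofX_toX, VariableChange.ofY_toY]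

/-- A rational point `T = (x₀, y₀)` of order `2` is put at `(0, 0)` on a model in two-torsion
normal form by the change of variables `(1, x₀, -a₁/2, y₀)` (`char K ≠ 2`): `a₁' = a₁ + 2s = 0`,
`a₃' = a₃ + x₀a₁ + 2y₀ = 0` because `2T = O` (`y₀ = -y₀ - a₁x₀ - a₃`), `a₆' = -f(x₀, y₀) = 0`.
Silverman, *AEC*, III.1 (Table 3.1) and X.4.9 (proof). [folklore] -/
theorem isTwoTorsionNF_smul_of_two_nsmul_eq_zero {W : WeierstrassCurve K} (h2 : (2 : K) ≠ 0)
    {x₀ y₀ : K} (h₀ : W.toAffine.Nonsingular x₀ y₀) (hy₀ : y₀ = W.toAffine.negY x₀ y₀) :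
    ((⟨1, x₀, -W.a₁ / 2, y₀⟩ : VariableChange K) • W).IsTwoTorsionNF := by
  have heq : y₀ ^ 2 + W.a₁ * x₀ * y₀ + W.a₃ * y₀ = x₀ ^ 3 + W.a₂ * x₀ ^ 2 + W.a₄ * x₀ + W.a₆ :=
    (Affine.equation_iff ..).mp h₀.left
  rw [Affine.negY] at hy₀
  refine ⟨?_, ?_, ?_⟩
  · simp only [variableChange_a₁, Units.val_one, inv_one, one_mul]
    field_simp
    ring
  · simp only [variableChange_a₃, Units.val_one, inv_one, one_pow, one_mul]
    linear_combination hy₀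
  · simp only [variableChange_a₆, Units.val_one, inv_one, one_pow, one_mul]
    linear_combination (-1 : K) * heq

/-- **Quotient of an elliptic curve by a rational point of order `2`.** Let `E` be an elliptic
curve over a field `K` with `char K ≠ 2` and `T ∈ E(K)` a point of order `2`. There are an
elliptic curve `B` over `K` and isogenies `g : E → B`, `f : B → E` over `K` with
`ker g = {O, T}` (on `K̄`-points), `f (g P) = 2P` and `g (f Q) = 2Q`: move `T` to `(0, 0)` and
`a₁ = a₃ = 0` by a change of variables over `K` (`isTwoTorsionNF_smul_of_two_nsmul_eq_zero`),
take Silverman's `2`-isogeny `φ` of the resulting `y² = x³ + ax² + bx` and its dual `φ'`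
(`exists_isogeny_twoIsogeny_comp_eq_two_nsmul`), and conjugate back. This is Silverman, *AEC*,
Prop. III.4.12 with Rem. III.4.13.2 (quotient by a finite `Γ_K`-stable subgroup) and
Thm. III.6.1–6.2 (dual isogeny) for `Φ = {O, T}`, made explicit by Example III.4.5.
[cite: SilvermanAEC2009, III.4 Example 4.5, Prop. III.4.12, Thm. III.6.1–6.2] -/
theorem exists_isogeny_ker_eq_pair (W : WeierstrassCurve K) [W.IsElliptic] (h2 : (2 : K) ≠ 0)
    {T₀ : W.toAffine.Point} (hT₀ : T₀ ≠ 0) (h2T₀ : 2 • T₀ = 0) :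
    ∃ (B : WeierstrassCurve K) (_ : B.IsElliptic) (g : Isogeny W B) (f : Isogeny B W),
      (∀ Q, g Q = 0 ↔ Q = 0 ∨ Q = W.toGeomPoints T₀) ∧ (∀ P, f (g P) = 2 • P) ∧
        ∀ Q, g (f Q) = 2 • Q := by
  rcases T₀ with _ | ⟨x₀, y₀, h₀⟩
  · exact absurd rfl hT₀
  -- `2T = O`: `y₀ = -y₀ - a₁x₀ - a₃`
  have hy₀ : y₀ = W.toAffine.negY x₀ y₀ := by
    by_contra hy
    apply Affine.Point.some_ne_zero (Affine.nonsingular_add h₀ h₀ fun hxy ↦ hy hxy.right)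
    rw [← Affine.Point.add_self_of_Y_ne (h₁ := h₀) hy, ← two_nsmul, h2T₀]
  -- the normal form
  set C : VariableChange K := ⟨1, x₀, -W.a₁ / 2, y₀⟩ with hC
  haveI : (C • W).IsTwoTorsionNF := isTwoTorsionNF_smul_of_two_nsmul_eq_zero h2 h₀ hy₀
  obtain ⟨f₁, hf₁⟩ := exists_isogeny_twoIsogeny_comp_eq_two_nsmul (C • W)
  -- the isogenies
  let g : Isogeny W (C • W).twoIsogenyCodomain :=
    (C • W).twoIsogeny.comp (VariableChange.toIsogeny W C)
  let f : Isogeny (C • W).twoIsogenyCodomain W :=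
    ((congrArg (Isogeny (C • W)) (inv_smul_smul C W)).mp
      (VariableChange.toIsogeny (C • W) C⁻¹)).comp f₁
  have hfg : ∀ P, f (g P) = 2 • P := fun P ↦ by
    show (congrArg (Isogeny (C • W)) (inv_smul_smul C W)).mp (VariableChange.toIsogeny (C • W) C⁻¹)
      (f₁ ((C • W).twoIsogeny (VariableChange.toIsogeny W C P))) = 2 • P
    rw [hf₁, map_nsmul, VariableChange.cast_toIsogeny_inv_toIsogeny]
  -- `T ↦ (0, 0)`
  have hT : VariableChange.toIsogeny W C (W.toGeomPoints (Affine.Point.some x₀ y₀ h₀)) =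
      (C • W).geomTwoTorsionPoint := by
    obtain ⟨hns, e₀⟩ : ∃ hns, W.toGeomPoints (Affine.Point.some x₀ y₀ h₀) =
        Affine.Point.some (algebraMap K (AlgebraicClosure K) x₀)
          (algebraMap K (AlgebraicClosure K) y₀) hns := ⟨_, rfl⟩
    rw [e₀, VariableChange.toIsogeny_some]
    have hx : (C.map (algebraMap K (AlgebraicClosure K))).toX (algebraMap K (AlgebraicClosure K) x₀) = 0 := by
      simp [hC, VariableChange.toX_def, VariableChange.map]
    have hy : (C.map (algebraMap K (AlgebraicClosure K))).toY (algebraMap K (AlgebraicClosure K) x₀)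
        (algebraMap K (AlgebraicClosure K) y₀) = 0 := by
      simp [hC, VariableChange.toY_def, VariableChange.map]
    obtain ⟨h', e'⟩ := Literature.NumberTheory.EllipticCurves.UnivEC.some_eq_some_of_eq hx hy
      ((VariableChange.baseChange_smul_eq W C (AlgebraicClosure K)) ▸
        (VariableChange.nonsingular_iff (W.baseChange (AlgebraicClosure K))
          (C.map (algebraMap K (AlgebraicClosure K))) _ _).mpr hns)
    exact e'
  refine ⟨(C • W).twoIsogenyCodomain, inferInstance, g, f, fun Q ↦ ?_, hfg,
    Isogeny.comp_apply_eq_nsmul_of_comp_apply_eq_nsmul g f hfg⟩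
  show (C • W).twoIsogeny (VariableChange.toIsogeny W C Q) = 0 ↔ _
  rw [twoIsogeny_apply, ← AddMonoidHom.mem_ker, mem_ker_twoIsogenyGeomHom_iff, ← hT,
    ← map_zero (VariableChange.toIsogeny W C), (VariableChange.toIsogeny_injective W C).eq_iff,
    (VariableChange.toIsogeny_injective W C).eq_iff]

/-! ## Quotients by Frobenius-stable cyclic `2`-power subgroups over a finite field -/

/-- An integer multiple of an element `T` with `2T = 0` is `0` or `T`. [folklore] -/
theorem zsmul_eq_zero_or_eq_of_two_nsmul_eq_zero {A : Type*} [AddCommGroup A] {T : A}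
    (h2T : 2 • T = 0) (k : ℤ) : k • T = 0 ∨ k • T = T := by
  obtain ⟨j, rfl | rfl⟩ := Int.even_or_odd' k
  · left
    rw [mul_comm, mul_smul, show (2 : ℤ) • T = 0 by exact_mod_cast h2T, smul_zero]
  · right
    rw [add_smul, one_smul, mul_comm, mul_smul, show (2 : ℤ) • T = 0 by exact_mod_cast h2T,
      smul_zero, zero_add]

/-- **Quotient of an elliptic curve over a finite field by a Frobenius-stable cyclic subgroup of
order `2 ^ n`.** Let `k` be a finite field of odd characteristic, `σ_q ∈ Γ_k` its arithmetic
Frobenius, `E` an elliptic curve over `k` and `P ∈ E(k̄)` a point of order `2 ^ n` with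
`σ_q P ∈ ⟨P⟩` (so that the cyclic group `⟨P⟩` is `Γ_k`-stable). Then there are an elliptic curve
`B` over `k` and isogenies `g : E → B`, `f : B → E` over `k` with `ker g = ⟨P⟩`,
`f (g Q) = 2ⁿ Q` and `g (f Q) = 2ⁿ Q`. Induction on `n`: the point `T = 2^{n-1} P` of order `2` is
fixed by `σ_q` (it is the only element of order `2` of `⟨P⟩`), hence `k`-rational
(`mem_range_toGeomPoints_of_smul_eq`); divide by it (`exists_isogeny_ker_eq_pair`) and apply the
induction hypothesis to the image of `P`, a point of order `2^{n-1}` on the quotient. This is the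
instance `S = ⟨P⟩`, `#S = 2ⁿ`, `k` finite, of Silverman, *AEC*, Prop. III.4.12 with
Rem. III.4.13.2 and Thm. III.6.1–6.2, as used by Tate, Invent. Math. 2 (1966), §2, proof of
Proposition 1 ("an isogeny `f_n : B(n) → A` of degree `ℓⁿ` defined over `k` such that
`f_n(T_ℓ(B(n))) = X_n`"). [cite: SilvermanAEC2009, Prop. III.4.12, Rem. III.4.13.2, Thm. III.6.1–6.2] -/
theorem exists_isogeny_ker_eq_zmultiples_of_addOrderOf_eq_two_pow [Finite K] (h2 : (2 : K) ≠ 0)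
    {σ : Field.absoluteGaloisGroup K} (hσ : ∀ x : AlgebraicClosure K, σ • x = x ^ Nat.card K)
    (n : ℕ) :
    ∀ (W : WeierstrassCurve K) [W.IsElliptic] (P : W.geomPoints), addOrderOf P = 2 ^ n →
      σ • P ∈ AddSubgroup.zmultiples P →
      ∃ (B : WeierstrassCurve K) (_ : B.IsElliptic) (g : Isogeny W B) (f : Isogeny B W),
        (∀ Q, g Q = 0 ↔ Q ∈ AddSubgroup.zmultiples P) ∧ (∀ Q, f (g Q) = 2 ^ n • Q) ∧
          ∀ Q, g (f Q) = 2 ^ n • Q := by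
  induction n with
  | zero =>
    intro W _ P hP _
    rw [pow_zero, AddMonoid.addOrderOf_eq_one_iff] at hP
    subst hP
    refine ⟨W, inferInstance, Isogeny.id W, Isogeny.id W, fun Q ↦ ?_, fun Q ↦ ?_, fun Q ↦ ?_⟩
    · rw [Isogeny.id_apply, AddSubgroup.zmultiples_zero_eq_bot, AddSubgroup.mem_bot]
    · rw [Isogeny.id_apply, Isogeny.id_apply, pow_zero, one_smul]
    · rw [Isogeny.id_apply, Isogeny.id_apply, pow_zero, one_smul]
  | succ n ih =>
    intro W _ P hP hstab
    -- the point `T = 2ⁿ P` of order `2`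
    have hT0 : 2 ^ n • P ≠ 0 := fun h0 ↦ by
      have hdvd := addOrderOf_dvd_iff_nsmul_eq_zero.mpr h0
      rw [hP, Nat.pow_dvd_pow_iff_le_right Nat.one_lt_two] at hdvd
      omega
    have h2T : 2 • (2 ^ n • P) = 0 := by
      rw [smul_smul, ← pow_succ', ← hP]
      exact addOrderOf_nsmul_eq_zero P
    -- `T` is fixed by the Frobenius, hence `k`-rational
    obtain ⟨k, hk⟩ := AddSubgroup.mem_zmultiples_iff.mp hstab
    have hfix : σ • (2 ^ n • P) = 2 ^ n • P := by
      rw [smul_comm, ← hk, smul_comm, ]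
      rcases zsmul_eq_zero_or_eq_of_two_nsmul_eq_zero h2T k with h0 | h1
      · exfalso
        refine hT0 ((smul_eq_zero_iff_eq σ).mp ?_)
        rw [smul_comm, ← hk, smul_comm, h0]
      · exact h1
    obtain ⟨T₀, hT₀⟩ := mem_range_toGeomPoints_of_smul_eq hσ hfix
    have hT₀0 : T₀ ≠ 0 := by
      rintro rfl
      exact hT0 (by rw [← hT₀, map_zero])
    have h2T₀ : 2 • T₀ = 0 := W.toGeomPoints_injective (by rw [map_nsmul, hT₀, h2T, map_zero])
    -- divide by `T`
    obtain ⟨B₁, _, g₁, f₁, hker₁, hfg₁, hgf₁⟩ := exists_isogeny_ker_eq_pair W h2 hT₀0 h2T₀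
    rw [hT₀] at hker₁
    -- the image of `P` has order `2ⁿ` and a Frobenius-stable cyclic group
    have hP₁ : addOrderOf (g₁ P) = 2 ^ n := by
      have hfin : 2 ^ n • g₁ P = 0 := by
        rw [← map_nsmul, hker₁]
        exact Or.inr rfl
      cases n with
      | zero =>
        rw [pow_zero, one_smul] at hfin
        rw [hfin, pow_zero, addOrderOf_zero]
      | succ m =>
        refine addOrderOf_eq_prime_pow (fun h0 ↦ ?_) hfin
        rw [← map_nsmul, hker₁] at h0
        rcases h0 with h0 | h0
        · have hdvd := addOrderOf_dvd_iff_nsmul_eq_zero.mpr h0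
          rw [hP, Nat.pow_dvd_pow_iff_le_right Nat.one_lt_two] at hdvd
          omega
        · rw [pow_succ, mul_comm, mul_smul, two_smul, left_eq_add] at h0
          have hdvd := addOrderOf_dvd_iff_nsmul_eq_zero.mpr h0
          rw [hP, Nat.pow_dvd_pow_iff_le_right Nat.one_lt_two] at hdvd
          omega
    have hstab₁ : σ • g₁ P ∈ AddSubgroup.zmultiples (g₁ P) := by
      rw [← Isogeny.map_smul, ← hk, map_zsmul]
      exact AddSubgroup.zsmul_mem _ (AddSubgroup.mem_zmultiples _) k
    -- the induction hypothesis on the quotient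
    obtain ⟨B, _, g', f', hker', hfg', hgf'⟩ := ih B₁ (g₁ P) hP₁ hstab₁
    refine ⟨B, inferInstance, g'.comp g₁, f₁.comp f', fun Q ↦ ?_, fun Q ↦ ?_, fun Q ↦ ?_⟩
    · rw [Isogeny.comp_apply, hker']
      constructor
      · intro hQ
        obtain ⟨j, hj⟩ := AddSubgroup.mem_zmultiples_iff.mp hQ
        have h0 : g₁ (Q - j • P) = 0 := by rw [map_sub, map_zsmul, hj, sub_self]
        rw [hker₁] at h0
        rcases h0 with h0 | h0
        · rw [sub_eq_zero] at h0
          rw [h0]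
          exact AddSubgroup.zsmul_mem _ (AddSubgroup.mem_zmultiples _) j
        · rw [sub_eq_iff_eq_add] at h0
          rw [h0]
          exact add_mem (AddSubgroup.nsmul_mem _ (AddSubgroup.mem_zmultiples _) _)
            (AddSubgroup.zsmul_mem _ (AddSubgroup.mem_zmultiples _) j)
      · intro hQ
        obtain ⟨j, rfl⟩ := AddSubgroup.mem_zmultiples_iff.mp hQ
        rw [map_zsmul]
        exact AddSubgroup.zsmul_mem _ (AddSubgroup.mem_zmultiples _) j
    · rw [Isogeny.comp_apply, Isogeny.comp_apply, hfg', map_nsmul, hfg₁, smul_smul, ← pow_succ]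
    · rw [Isogeny.comp_apply, Isogeny.comp_apply, hgf₁, map_nsmul, hgf', smul_smul, ← pow_succ']

end WeierstrassCurve
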